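import Mathlib.MeasureTheory.Group.Prod
import Mathlib.MeasureTheory.Measure.Haar.Unique
import Mathlib.Analysis.SpecialFunctions.Integrals.Basic
import Mathlib.Analysis.Real.Pi.Bounds
import Literature.MathematicalPhysics.StatisticalMechanics.HardDiscVirialProofs
import HarnessLib

/-!
# Volumes of the ring and diamond Mayer diagrams of hard discs
(towards the named fact `ClisbyMcCoy2004_B4_hardDiscs` of `HardDiscVirial.lean`:
`B₄/B₂³ = 2 − 9√3/(2π) + 10/π²`, Rowlinson 1964 / Hemmer 1964 as quoted in Clisby–McCoy 2004 §1)

Second file of the hard-disc virial computations, after `HardDiscVirialProofs.lean` (lens area,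
triangle diagram `V(K₃)`, discharge of `B₃`). In product coordinates
`x = (r₃, (r₂, r₄)) ∈ (ℝ × ℝ) × (ℝ × ℝ) × (ℝ × ℝ)` (pivot `r₃` first):

* `volume_ringProd`: the ring diagram `{|r₂| < 1, |r₂ − r₃| < 1, |r₃ − r₄| < 1, |r₄| < 1}` has
  volume `2π · (π²/2 − 8/3)` (`= π³ − 16π/3`);
* `volume_diamondProd`: with the chord `|r₃| < 1` added, `2π · (π²/2 − (√3/2)π − 5/12)`
  (`= π³ − √3π² − 5π/6`).

## Proof (classical; Tonelli, polar coordinates, one substitution)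

The `r₃`-slices of both sets are squares `L(r₃) × L(r₃)` of the lens `L(p) = D(0) ∩ D(p)` of two
unit discs (`slice_ringProd`, `slice_diamondProd`), of area `A(|p|)` with
`A(ρ) = π − 2 arcsin(ρ/2) − ρ√(1 − ρ²/4)` for EVERY `ρ ≥ 0` (`volume_lensAt_eq`: the tree's
`HardDiscTriangleVolume.volume_lensAt` reduces a general centre to the standard lens, and
`volume_lens_axis` computes the latter at all distances as a region between two graphs; `A = 0`
for `ρ ≥ 2`, `lensArea_eq_zero`, and `A ≥ 0`, `lensArea_nonneg`). Tonelli and polar coordinates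
(`lintegral_radial`) give `V = 2π ∫ r·A(r)² dr` over `(0, 2)`, resp. `(0, 1)`; the substitution
`r = 2cos(x/2)` turns `A` into `x − sin x` (`lensArea_two_mul_cos`) and the radial integrals into
`∫ sin x (x − sin x)² dx` over `(0, π)`, resp. `(2π/3, π)` (`integral_ringRadial`,
`integral_diamondRadial`), evaluated with an explicit antiderivative (`hasDerivAt_ringPrim`).

Also recorded here for the star diagram (`HardDiscVirialStarProofs.lean`,
`HardDiscVirialB4Proofs.lean`): null sets with null sections (`prod_null_of_sections`), circles
are null (`volume_circle_eq_zero`), `∫ (v − t)₊` over an interval (`lintegral_ofReal_sub_Ioo`),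
the primitive of `√(1 − x²)` (`integral_sqrt_one_sub_sq'`) and the derivative of the monomials
`xᵏ sinⁱx cosʲx` (`hasDerivAt_monomial`). Everything is elementary ([folklore]); no definitions
and no named facts are introduced (sub-namespace `HardDiscB4Volume`).

## References

* [ClisbyMccoy2004] N. Clisby, B. M. McCoy, *Analytic calculation of B₄ for hard spheres in even
  dimensions*, J. Stat. Phys. 114 (2004) 1343–1361, §1 (Mayer expansion of `B₄`; the `D = 2`
  value, citing J. S. Rowlinson, Mol. Phys. 7 (1964) 593 and P. C. Hemmer, J. Chem. Phys. 42
  (1964) 1116).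
-/

noncomputable section

open MeasureTheory Set Real Filter
open scoped ENNReal

namespace Literature.MathematicalPhysics.StatisticalMechanics

namespace HardDiscB4Volume


/-! ### Generic measure-theoretic helpers -/

/-- A measurable set in a product all of whose sections (second factor) are null is null.
[folklore] -/
theorem prod_null_of_sections {α β : Type*} [MeasurableSpace α] [MeasurableSpace β]
    {μ : Measure α} {ν : Measure β} [SFinite ν] {s : Set (α × β)} (hs : MeasurableSet s)
    (h : ∀ a, ν (Prod.mk a ⁻¹' s) = 0) : μ.prod ν s = 0 := by
  rw [Measure.prod_apply hs]; simp [h]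

/-- A measurable set in a product all of whose sections (first factor) are null is null.
[folklore] -/
theorem prod_null_of_sections_symm {α β : Type*} [MeasurableSpace α] [MeasurableSpace β]
    {μ : Measure α} {ν : Measure β} [SFinite ν] [SFinite μ] {s : Set (α × β)}
    (hs : MeasurableSet s) (h : ∀ b, μ ((fun a => (a, b)) ⁻¹' s) = 0) : μ.prod ν s = 0 := by
  rw [Measure.prod_apply_symm hs]; simp [h]

/-- A circle (possibly degenerate) in `ℝ × ℝ` is Lebesgue-null (its vertical sections have at
most two points). [folklore] -/
theorem volume_circle_eq_zero (a b R : ℝ) :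
    volume {y : ℝ × ℝ | (y.1 - a) ^ 2 + (y.2 - b) ^ 2 = R} = 0 := by
  have hmeas : MeasurableSet {y : ℝ × ℝ | (y.1 - a) ^ 2 + (y.2 - b) ^ 2 = R} :=
    measurableSet_eq_fun (by fun_prop) (by fun_prop)
  refine prod_null_of_sections (μ := volume) (ν := volume) hmeas fun s => ?_
  refine measure_mono_null (t := {b + Real.sqrt (R - (s - a) ^ 2), b - Real.sqrt (R - (s - a) ^ 2)})
    ?_ ((Set.toFinite _).measure_zero _)
  intro t ht
  simp only [mem_preimage, mem_setOf_eq] at ht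
  simp only [mem_insert_iff, mem_singleton_iff]
  have hq : (t - b) ^ 2 = R - (s - a) ^ 2 := by linarith
  have habs : |t - b| = Real.sqrt (R - (s - a) ^ 2) := by
    rw [← hq, Real.sqrt_sq_eq_abs]
  rcases (abs_eq (Real.sqrt_nonneg _)).1 habs with h | h
  · left; linarith
  · right; linarith

/-- Polar coordinates for a radial function on `ℝ × ℝ`:
`∫ F(|p|²) dp = 2π ∫_{r>0} r F(r²) dr`. [folklore] -/
theorem lintegral_radial (F : ℝ → ℝ≥0∞) (hF : Measurable F) :
    ∫⁻ p : ℝ × ℝ, F (p.1 ^ 2 + p.2 ^ 2) =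
      ENNReal.ofReal (2 * π) * ∫⁻ r in Ioi (0:ℝ), ENNReal.ofReal r * F (r ^ 2) := by
  rw [← lintegral_comp_polarCoord_symm]
  have h1 : ∀ p ∈ polarCoord.target,
      ENNReal.ofReal p.1 • (fun q : ℝ × ℝ => F (q.1 ^ 2 + q.2 ^ 2)) (polarCoord.symm p) =
        (fun r : ℝ => ENNReal.ofReal r * F (r ^ 2)) p.1 * (fun _ : ℝ => (1 : ℝ≥0∞)) p.2 := by
    intro p _
    simp only [polarCoord_symm_apply, smul_eq_mul, mul_one]
    congr 2
    have := Real.cos_sq_add_sin_sq p.2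
    linear_combination p.1 ^ 2 * this
  have hf : AEMeasurable (fun r : ℝ => ENNReal.ofReal r * F (r ^ 2)) (volume.restrict (Ioi 0)) := by
    fun_prop
  rw [setLIntegral_congr_fun polarCoord.open_target.measurableSet h1, polarCoord_target,
    Measure.volume_eq_prod, ← Measure.prod_restrict,
    lintegral_prod_mul hf aemeasurable_const, lintegral_const,
    Measure.restrict_apply_univ, Real.volume_Ioo, one_mul, mul_comm]
  congr 2; ring

/-- `∫_{(a,b)} (v − t)₊ dv = (b − t)₊²/2` for `a ≤ t` (as an `ofReal` `lintegral`). [folklore] -/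
theorem lintegral_ofReal_sub_Ioo {a b t : ℝ} (hat : a ≤ t) :
    ∫⁻ v in Ioo a b, ENNReal.ofReal (v - t) = ENNReal.ofReal ((max (b - t) 0) ^ 2 / 2) := by
  rcases le_or_gt b t with hbt | htb
  · have h0 : ∀ v ∈ Ioo a b, ENNReal.ofReal (v - t) = 0 := fun v hv =>
      ENNReal.ofReal_of_nonpos (by linarith [hv.2])
    rw [setLIntegral_congr_fun measurableSet_Ioo h0, lintegral_zero, max_eq_right (by linarith)]
    simp
  · have hsplit : Ioo a b = Ioc a t ∪ Ioo t b := (Ioc_union_Ioo_eq_Ioo hat htb).symm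
    have hdisj : Disjoint (Ioc a t) (Ioo t b) :=
      disjoint_left.2 fun x hx hx' => (hx.2.trans_lt hx'.1).false
    rw [hsplit, lintegral_union measurableSet_Ioo hdisj]
    have h0 : ∀ v ∈ Ioc a t, ENNReal.ofReal (v - t) = 0 := fun v hv =>
      ENNReal.ofReal_of_nonpos (by linarith [hv.2])
    rw [setLIntegral_congr_fun measurableSet_Ioc h0, lintegral_zero, zero_add,
      max_eq_left (by linarith)]
    have hint : IntegrableOn (fun v : ℝ => v - t) (Ioo t b) volume :=
      ((continuous_id.sub continuous_const).integrableOn_Icc).mono_set Ioo_subset_Icc_self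
    have hnn : 0 ≤ᵐ[volume.restrict (Ioo t b)] fun v : ℝ => v - t := by
      rw [EventuallyLE, ae_restrict_iff' measurableSet_Ioo]
      exact ae_of_all _ fun v hv => by simp only [Pi.zero_apply]; linarith [hv.1]
    rw [← ofReal_integral_eq_lintegral_ofReal hint hnn]
    congr 1
    rw [← integral_Ioc_eq_integral_Ioo, ← intervalIntegral.integral_of_le htb.le,
      intervalIntegral.integral_sub intervalIntegral.intervalIntegrable_id intervalIntegrable_const,
      integral_id, intervalIntegral.integral_const]
    simp only [smul_eq_mul]
    ring

/-- `∫_{(a,b)} (t − v)₊ dv = (t − a)₊²/2` for `t ≤ b` (mirror image of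
`lintegral_ofReal_sub_Ioo`). [folklore] -/
theorem lintegral_ofReal_sub_Ioo' {a b t : ℝ} (htb : t ≤ b) :
    ∫⁻ v in Ioo a b, ENNReal.ofReal (t - v) = ENNReal.ofReal ((max (t - a) 0) ^ 2 / 2) := by
  have hmp : MeasurePreserving (fun v : ℝ => -v) volume volume :=
    Measure.measurePreserving_neg volume
  have hset : (fun v : ℝ => -v) ⁻¹' (Ioo (-b) (-a)) = Ioo a b := by
    ext v; simp only [mem_preimage, mem_Ioo]; constructor <;> intro h <;> constructor <;> linarith
  have := hmp.setLIntegral_comp_preimage (s := Ioo (-b) (-a))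
    (f := fun w => ENNReal.ofReal (w - (-t))) measurableSet_Ioo (by fun_prop)
  rw [hset] at this
  simp only [sub_neg_eq_add] at this
  have h2 : ∀ v : ℝ, ENNReal.ofReal (t - v) = ENNReal.ofReal (-v + t) := fun v => by ring_nf
  simp_rw [h2, this]
  have h3 := lintegral_ofReal_sub_Ioo (a := -b) (b := -a) (t := -t) (by linarith)
  simp only [sub_neg_eq_add] at h3
  rw [h3]; congr 3; ring


/-! ### The primitive of `√(1 - x²)` and circular-segment integrals -/

/-- `d/dx [(x√(1−x²) + arcsin x)/2] = √(1 − x²)` on `(−1, 1)`. [folklore] -/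
theorem hasDerivAt_circPrim {x : ℝ} (hx1 : -1 < x) (hx2 : x < 1) :
    HasDerivAt (fun x : ℝ => (x * Real.sqrt (1 - x ^ 2) + Real.arcsin x) / 2)
      (Real.sqrt (1 - x ^ 2)) x := by
  have hu : 0 < 1 - x ^ 2 := by nlinarith
  have h1 : HasDerivAt (fun x : ℝ => 1 - x ^ 2) (-(2 * x)) x := by
    simpa using (hasDerivAt_pow 2 x).const_sub 1
  have h2 : HasDerivAt (fun x : ℝ => Real.sqrt (1 - x ^ 2))
      (-(2 * x) / (2 * Real.sqrt (1 - x ^ 2))) x := h1.sqrt hu.ne'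
  have h3 := (hasDerivAt_id x).mul h2
  have h4 : HasDerivAt Real.arcsin (1 / Real.sqrt (1 - x ^ 2)) x :=
    Real.hasDerivAt_arcsin hx1.ne' hx2.ne
  have h5 := (h3.add h4).div_const 2
  have hs : Real.sqrt (1 - x ^ 2) ^ 2 = 1 - x ^ 2 := Real.sq_sqrt hu.le
  have hsne : Real.sqrt (1 - x ^ 2) ≠ 0 := (Real.sqrt_pos.2 hu).ne'
  have heq : (1 * Real.sqrt (1 - x ^ 2) + id x * (-(2 * x) / (2 * Real.sqrt (1 - x ^ 2))) +
      1 / Real.sqrt (1 - x ^ 2)) / 2 = Real.sqrt (1 - x ^ 2) := by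
    field_simp
    simp only [id]
    nlinarith [hs]
  exact heq ▸ h5

/-- The primitive `(x√(1−x²) + arcsin x)/2` is continuous. [folklore] -/
theorem continuous_circPrim :
    Continuous (fun x : ℝ => (x * Real.sqrt (1 - x ^ 2) + Real.arcsin x) / 2) := by
  have : Continuous fun x : ℝ => Real.sqrt (1 - x ^ 2) := Real.continuous_sqrt.comp (by fun_prop)
  exact ((continuous_id.mul this).add Real.continuous_arcsin).div_const 2

/-- `∫ₐᵇ √(1 − x²) dx = F(b) − F(a)`, `F(x) = (x√(1−x²) + arcsin x)/2`, for `−1 ≤ a ≤ b ≤ 1`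
(the area of a circular segment). [folklore] -/
theorem integral_sqrt_one_sub_sq' {a b : ℝ} (ha : -1 ≤ a) (hab : a ≤ b) (hb : b ≤ 1) :
    ∫ x in a..b, Real.sqrt (1 - x ^ 2) =
      (b * Real.sqrt (1 - b ^ 2) + Real.arcsin b) / 2 -
        (a * Real.sqrt (1 - a ^ 2) + Real.arcsin a) / 2 := by
  have hc : Continuous fun x : ℝ => Real.sqrt (1 - x ^ 2) := Real.continuous_sqrt.comp (by fun_prop)
  refine intervalIntegral.integral_eq_sub_of_hasDerivAt_of_le hab continuous_circPrim.continuousOn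
    (fun x hx => hasDerivAt_circPrim (by linarith [hx.1]) (by linarith [hx.2]))
    (hc.intervalIntegrable _ _)

/-! ### Area of the lens `D(0) ∩ D((ρ,0))` -/

/-- The lens of two unit discs at centre distance `ρ ≥ 0` has area
`π - 2 arcsin(ρ/2) - ρ √(1 - ρ²/4)` (`= 2 arccos(ρ/2) - (ρ/2)√(4-ρ²)`, and `0` for `ρ ≥ 2`):
slice at fixed abscissa (a region between two graphs) and the primitive of `√(1 − x²)`.
[folklore] -/
theorem volume_lens_axis {ρ : ℝ} (hρ : 0 ≤ ρ) :
    volume {y : ℝ × ℝ | y.1 ^ 2 + y.2 ^ 2 < 1 ∧ (y.1 - ρ) ^ 2 + y.2 ^ 2 < 1} =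
      ENNReal.ofReal (π - 2 * Real.arcsin (ρ / 2) - ρ * Real.sqrt (1 - (ρ / 2) ^ 2)) := by
  rcases le_or_gt 2 ρ with h2 | h2
  · have hempty : {y : ℝ × ℝ | y.1 ^ 2 + y.2 ^ 2 < 1 ∧ (y.1 - ρ) ^ 2 + y.2 ^ 2 < 1} = ∅ := by
      ext ⟨a, b⟩
      simp only [mem_setOf_eq, mem_empty_iff_false, iff_false, not_and]
      intro h1 h3
      nlinarith [sq_nonneg b, sq_nonneg (a - 1), sq_nonneg (a - ρ + 1)]
    rw [hempty, measure_empty, Real.arcsin_of_one_le (by linarith),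
      Real.sqrt_eq_zero'.2 (by nlinarith)]
    rw [eq_comm, ENNReal.ofReal_eq_zero]
    linarith
  · set g : ℝ → ℝ := fun a => Real.sqrt (1 - max (a ^ 2) ((a - ρ) ^ 2)) with hg
    have hset : {y : ℝ × ℝ | y.1 ^ 2 + y.2 ^ 2 < 1 ∧ (y.1 - ρ) ^ 2 + y.2 ^ 2 < 1} =
        regionBetween (-g) g (Ioo (ρ - 1) 1) := by
      ext ⟨a, b⟩
      simp only [mem_setOf_eq, regionBetween, mem_Ioo, Pi.neg_apply]
      constructor
      · rintro ⟨h1, h3⟩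
        have ha1 : a < 1 := by nlinarith [sq_nonneg b, sq_nonneg (a + 1)]
        have ha2 : ρ - 1 < a := by nlinarith [sq_nonneg b, sq_nonneg (a - ρ - 1)]
        have hb : |b| < g a := by
          apply Real.lt_sqrt_of_sq_lt
          rw [sq_abs]
          have := max_lt (b := a ^ 2) (c := (a - ρ) ^ 2) (a := 1 - b ^ 2) (by linarith)
            (by linarith)
          linarith
        exact ⟨⟨ha2, ha1⟩, by linarith [(abs_lt.1 hb).1], (abs_lt.1 hb).2⟩
      · rintro ⟨⟨ha2, ha1⟩, hb1, hb2⟩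
        have hb : |b| < g a := abs_lt.2 ⟨hb1, hb2⟩
        have hb2' : b ^ 2 < 1 - max (a ^ 2) ((a - ρ) ^ 2) := by
          have := (Real.lt_sqrt (abs_nonneg b)).1 hb
          rwa [sq_abs] at this
        have hm1 := le_max_left (a ^ 2) ((a - ρ) ^ 2)
        have hm2 := le_max_right (a ^ 2) ((a - ρ) ^ 2)
        constructor <;> linarith
    have hgcont : Continuous g := Real.continuous_sqrt.comp (by fun_prop)
    have hgnn : ∀ a, 0 ≤ g a := fun a => Real.sqrt_nonneg _
    rw [hset, Measure.volume_eq_prod,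
      volume_regionBetween_eq_integral (hgcont.neg.integrableOn_Icc.mono_set Ioo_subset_Icc_self)
        (hgcont.integrableOn_Icc.mono_set Ioo_subset_Icc_self) measurableSet_Ioo
        (fun a _ => by simp only [Pi.neg_apply]; linarith [hgnn a])]
    congr 1
    have h2g : ∫ a in Ioo (ρ - 1) 1, (g - (-g)) a = 2 * ∫ a in (ρ - 1)..1, g a := by
      rw [intervalIntegral.integral_of_le (by linarith), integral_Ioc_eq_integral_Ioo,
        ← integral_const_mul]
      congr 1; ext a; simp only [Pi.sub_apply, Pi.neg_apply]; ring
    rw [h2g]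
    have hρ1 : ρ - 1 ≤ ρ / 2 := by linarith
    have hρ2 : ρ / 2 ≤ 1 := by linarith
    rw [← intervalIntegral.integral_add_adjacent_intervals (b := ρ / 2)
        (hgcont.intervalIntegrable _ _) (hgcont.intervalIntegrable _ _)]
    -- left piece
    have hL : ∫ a in (ρ - 1)..(ρ / 2), g a =
        ∫ a in (ρ - 1)..(ρ / 2), Real.sqrt (1 - (a - ρ) ^ 2) := by
      apply intervalIntegral.integral_congr
      intro a ha
      rw [uIcc_of_le hρ1] at ha
      simp only [hg]
      rw [max_eq_right (by nlinarith [ha.2])]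
    have hL' : ∫ a in (ρ - 1)..(ρ / 2), Real.sqrt (1 - (a - ρ) ^ 2) =
        ∫ a in (-1:ℝ)..(-(ρ / 2)), Real.sqrt (1 - a ^ 2) := by
      rw [intervalIntegral.integral_comp_sub_right (fun a => Real.sqrt (1 - a ^ 2)) ρ]
      congr 1 <;> ring
    have hR : ∫ a in (ρ / 2)..1, g a = ∫ a in (ρ / 2)..1, Real.sqrt (1 - a ^ 2) := by
      apply intervalIntegral.integral_congr
      intro a ha
      rw [uIcc_of_le hρ2] at ha
      simp only [hg]
      rw [max_eq_left (by nlinarith [ha.1])]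
    rw [hL, hL', hR, integral_sqrt_one_sub_sq' (by linarith) (by linarith) (by linarith),
      integral_sqrt_one_sub_sq' (by linarith) hρ2 le_rfl]
    simp only [Real.arcsin_neg, Real.arcsin_one, one_pow, sub_self,
      Real.sqrt_zero, mul_zero, zero_add, even_two, Even.neg_pow]
    ring


/-! ### Lens area at all distances (arcsin form), general centre -/

/-- The standard lens `{|q| < 1, |q − (0,ρ)| < 1}` has area `π − 2 arcsin(ρ/2) − ρ√(1−ρ²/4)`
for every `ρ ≥ 0` (zero for `ρ ≥ 2`). [folklore] -/
theorem volume_stdLens {ρ : ℝ} (hρ : 0 ≤ ρ) :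
    volume {q : ℝ × ℝ | q.1 ^ 2 + q.2 ^ 2 < 1 ∧ q.1 ^ 2 + (q.2 - ρ) ^ 2 < 1} =
      ENNReal.ofReal (π - 2 * Real.arcsin (ρ / 2) - ρ * Real.sqrt (1 - (ρ / 2) ^ 2)) := by
  have h := HardDiscTriangleVolume.volume_lensAt ρ 0
  have hs : Real.sqrt (ρ ^ 2 + 0 ^ 2) = ρ := by
    rw [zero_pow two_ne_zero, add_zero, Real.sqrt_sq hρ]
  rw [hs] at h
  rw [← h]
  have hset : {q : ℝ × ℝ | q.1 ^ 2 + q.2 ^ 2 < 1 ∧ (ρ - q.1) ^ 2 + (0 - q.2) ^ 2 < 1} =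
      {y : ℝ × ℝ | y.1 ^ 2 + y.2 ^ 2 < 1 ∧ (y.1 - ρ) ^ 2 + y.2 ^ 2 < 1} := by
    ext q
    simp only [mem_setOf_eq]
    rw [show (ρ - q.1) ^ 2 + (0 - q.2) ^ 2 = (q.1 - ρ) ^ 2 + q.2 ^ 2 by ring]
  rw [hset, volume_lens_axis hρ]

/-- The lens of unit discs centred at `0` and `(a, b)` has area
`π − 2 arcsin(ρ/2) − ρ√(1−ρ²/4)`, `ρ = √(a²+b²)`. [folklore] -/
theorem volume_lensAt_eq (a b : ℝ) :
    volume {q : ℝ × ℝ | q.1 ^ 2 + q.2 ^ 2 < 1 ∧ (a - q.1) ^ 2 + (b - q.2) ^ 2 < 1} =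
      ENNReal.ofReal (π - 2 * Real.arcsin (Real.sqrt (a ^ 2 + b ^ 2) / 2) -
        Real.sqrt (a ^ 2 + b ^ 2) * Real.sqrt (1 - (Real.sqrt (a ^ 2 + b ^ 2) / 2) ^ 2)) := by
  rw [HardDiscTriangleVolume.volume_lensAt, volume_stdLens (Real.sqrt_nonneg _)]

/-- The lens-area expression `π − 2 arcsin(r/2) − r√(1−r²/4)` is nonnegative for `r ≥ 0`
(it equals `x − sin x` with `x = π − 2 arcsin(r/2) ≥ 0`). [folklore] -/
theorem lensArea_nonneg {r : ℝ} (hr : 0 ≤ r) :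
    0 ≤ π - 2 * Real.arcsin (r / 2) - r * Real.sqrt (1 - (r / 2) ^ 2) := by
  rcases le_or_gt 2 r with h | h
  · rw [Real.arcsin_of_one_le (by linarith), Real.sqrt_eq_zero'.2 (by nlinarith)]
    linarith
  · set θ := Real.arcsin (r / 2) with hθ
    have hsin : Real.sin θ = r / 2 := Real.sin_arcsin (by linarith) (by linarith)
    have hcos : Real.cos θ = Real.sqrt (1 - (r / 2) ^ 2) := Real.cos_arcsin _
    have h1 : r * Real.sqrt (1 - (r / 2) ^ 2) = Real.sin (π - 2 * θ) := by
      rw [Real.sin_pi_sub, Real.sin_two_mul, hsin, hcos]; ring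
    have h3 : 0 ≤ π - 2 * θ := by linarith [Real.arcsin_le_pi_div_two (r / 2)]
    have h4 := Real.sin_le h3
    linarith

/-- The lens-area expression vanishes for `r ≥ 2`. [folklore] -/
theorem lensArea_eq_zero {r : ℝ} (hr : 2 ≤ r) :
    π - 2 * Real.arcsin (r / 2) - r * Real.sqrt (1 - (r / 2) ^ 2) = 0 := by
  rw [Real.arcsin_of_one_le (by linarith), Real.sqrt_eq_zero'.2 (by nlinarith)]
  ring

/-- Along the substitution `r = 2 cos(x/2)`, `x ∈ [0, π]`, the lens area is `x − sin x`.
[folklore] -/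
theorem lensArea_two_mul_cos {x : ℝ} (h0 : 0 ≤ x) (hπ : x ≤ π) :
    π - 2 * Real.arcsin (2 * Real.cos (x / 2) / 2) -
      2 * Real.cos (x / 2) * Real.sqrt (1 - (2 * Real.cos (x / 2) / 2) ^ 2) =
        x - Real.sin x := by
  have hc : 2 * Real.cos (x / 2) / 2 = Real.cos (x / 2) := by ring
  rw [hc]
  have h1 : Real.arcsin (Real.cos (x / 2)) = π / 2 - x / 2 := by
    rw [← Real.sin_pi_div_two_sub, Real.arcsin_sin (by linarith [Real.pi_pos])
      (by linarith [Real.pi_pos])]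
  have hs0 : 0 ≤ Real.sin (x / 2) :=
    Real.sin_nonneg_of_nonneg_of_le_pi (by linarith) (by linarith [Real.pi_pos])
  have h2 : Real.sqrt (1 - Real.cos (x / 2) ^ 2) = Real.sin (x / 2) := by
    rw [← Real.sin_sq, Real.sqrt_sq hs0]
  have h3 : Real.sin x = 2 * Real.sin (x / 2) * Real.cos (x / 2) := by
    rw [← Real.sin_two_mul]; congr 1; ring
  rw [h1, h2, h3]
  ring

/-! ### Trigonometric antiderivatives -/

/-- Derivative of the monomial `x^k sin^i x cos^j x`. [folklore] -/
theorem hasDerivAt_monomial (k i j : ℕ) (x : ℝ) :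
    HasDerivAt (fun x : ℝ => x ^ k * Real.sin x ^ i * Real.cos x ^ j)
      ((((k:ℕ):ℝ) * x ^ (k - 1) * Real.sin x ^ i
          + x ^ k * (((i:ℕ):ℝ) * Real.sin x ^ (i - 1) * Real.cos x)) * Real.cos x ^ j
        + x ^ k * Real.sin x ^ i * (((j:ℕ):ℝ) * Real.cos x ^ (j - 1) * -Real.sin x)) x :=
  ((hasDerivAt_pow k x).fun_mul ((Real.hasDerivAt_sin x).fun_pow i)).fun_mul
    ((Real.hasDerivAt_cos x).fun_pow j)

/-- An antiderivative of `sin x · (x − sin x)²`. [folklore] -/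
theorem hasDerivAt_ringPrim (x : ℝ) :
    HasDerivAt (fun x : ℝ =>
      ((1:ℝ)) * (x ^ 0 * Real.sin x ^ 0 * Real.cos x ^ 1) +
        ((1/3:ℝ)) * (x ^ 0 * Real.sin x ^ 0 * Real.cos x ^ 3) +
        ((-1/2:ℝ)) * (x ^ 0 * Real.sin x ^ 2 * Real.cos x ^ 0) +
        ((2:ℝ)) * (x ^ 1 * Real.sin x ^ 1 * Real.cos x ^ 0) +
        ((1:ℝ)) * (x ^ 1 * Real.sin x ^ 1 * Real.cos x ^ 1) +
        ((-1/2:ℝ)) * (x ^ 2 * Real.sin x ^ 0 * Real.cos x ^ 0) +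
        ((-1:ℝ)) * (x ^ 2 * Real.sin x ^ 0 * Real.cos x ^ 1))
      (Real.sin x * (x - Real.sin x) ^ 2) x := by
  have h0 := (hasDerivAt_monomial 0 0 1 x).const_mul ((1:ℝ))
  have h1 := h0.fun_add
    ((hasDerivAt_monomial 0 0 3 x).const_mul ((1/3:ℝ)))
  have h2 := h1.fun_add
    ((hasDerivAt_monomial 0 2 0 x).const_mul ((-1/2:ℝ)))
  have h3 := h2.fun_add
    ((hasDerivAt_monomial 1 1 0 x).const_mul ((2:ℝ)))
  have h4 := h3.fun_add
    ((hasDerivAt_monomial 1 1 1 x).const_mul ((1:ℝ)))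
  have h5 := h4.fun_add
    ((hasDerivAt_monomial 2 0 0 x).const_mul ((-1/2:ℝ)))
  have h6 := h5.fun_add
    ((hasDerivAt_monomial 2 0 1 x).const_mul ((-1:ℝ)))
  refine h6.congr_deriv ?_
  linear_combination ((-1:ℝ)*Real.sin x + (1:ℝ)*x) *
    Real.sin_sq_add_cos_sq x

/-- `∫₀^π sin x (x − sin x)² dx = π²/2 − 8/3`. [folklore] -/
theorem integral_sin_mul_sq_zero_pi :
    ∫ x in (0:ℝ)..π, Real.sin x * (x - Real.sin x) ^ 2 = π ^ 2 / 2 - 8 / 3 := by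
  rw [intervalIntegral.integral_eq_sub_of_hasDerivAt (fun x _ => hasDerivAt_ringPrim x)
    ((by fun_prop : Continuous fun x : ℝ => Real.sin x * (x - Real.sin x) ^ 2).intervalIntegrable
      _ _)]
  simp only [Real.sin_pi, Real.cos_pi, Real.sin_zero, Real.cos_zero]
  ring

/-- `∫_{2π/3}^π sin x (x − sin x)² dx = π²/2 − (√3/2)π − 5/12`. [folklore] -/
theorem integral_sin_mul_sq_twoPiDivThree_pi :
    ∫ x in (2 * π / 3:ℝ)..π, Real.sin x * (x - Real.sin x) ^ 2 =
      π ^ 2 / 2 - Real.sqrt 3 / 2 * π - 5 / 12 := by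
  rw [intervalIntegral.integral_eq_sub_of_hasDerivAt (fun x _ => hasDerivAt_ringPrim x)
    ((by fun_prop : Continuous fun x : ℝ => Real.sin x * (x - Real.sin x) ^ 2).intervalIntegrable
      _ _)]
  have hs : Real.sin (2 * π / 3) = Real.sqrt 3 / 2 := by
    rw [show 2 * π / 3 = π - π / 3 by ring, Real.sin_pi_sub, Real.sin_pi_div_three]
  have hc : Real.cos (2 * π / 3) = -(1 / 2) := by
    rw [show 2 * π / 3 = π - π / 3 by ring, Real.cos_pi_sub, Real.cos_pi_div_three]
  simp only [Real.sin_pi, Real.cos_pi, hs, hc]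
  have h3 : Real.sqrt 3 ^ 2 = 3 := Real.sq_sqrt (by norm_num)
  linear_combination (1 / 8 : ℝ) * h3

/-- `∫₀² r·A(r)² dr = π²/2 − 8/3` for the lens area `A` (substitution `r = 2cos(x/2)`).
[folklore] -/
theorem integral_ringRadial :
    ∫ r in (0:ℝ)..2, r * (π - 2 * Real.arcsin (r / 2) - r * Real.sqrt (1 - (r / 2) ^ 2)) ^ 2 =
      π ^ 2 / 2 - 8 / 3 := by
  have hderiv : ∀ x ∈ uIcc (0:ℝ) π,
      HasDerivAt (fun x : ℝ => 2 * Real.cos (x / 2)) (-Real.sin (x / 2)) x := by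
    intro x _
    have := (((hasDerivAt_id x).div_const 2).cos).const_mul 2
    refine this.congr_deriv ?_
    simp only [id]; ring
  have hcont : ContinuousOn (fun x : ℝ => -Real.sin (x / 2)) (uIcc (0:ℝ) π) :=
    (by fun_prop : Continuous fun x : ℝ => -Real.sin (x / 2)).continuousOn
  have hg : ContinuousOn (fun r : ℝ => r * (π - 2 * Real.arcsin (r / 2) -
      r * Real.sqrt (1 - (r / 2) ^ 2)) ^ 2) ((fun x : ℝ => 2 * Real.cos (x / 2)) '' uIcc (0:ℝ) π) :=
    (by fun_prop : Continuous fun r : ℝ => r * (π - 2 * Real.arcsin (r / 2) -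
      r * Real.sqrt (1 - (r / 2) ^ 2)) ^ 2).continuousOn
  have key := intervalIntegral.integral_comp_mul_deriv' hderiv hcont hg
  simp only [Function.comp_apply, zero_div] at key
  rw [Real.cos_zero, mul_one, Real.cos_pi_div_two, mul_zero,
    intervalIntegral.integral_symm (0:ℝ) 2] at key
  have key2 : ∫ r in (0:ℝ)..2, r * (π - 2 * Real.arcsin (r / 2) -
      r * Real.sqrt (1 - (r / 2) ^ 2)) ^ 2 =
      ∫ x in (0:ℝ)..π, Real.sin x * (x - Real.sin x) ^ 2 := by
    rw [← neg_eq_iff_eq_neg.mpr key, ← intervalIntegral.integral_neg]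
    apply intervalIntegral.integral_congr
    intro x hx
    rw [uIcc_of_le Real.pi_pos.le] at hx
    simp only
    rw [lensArea_two_mul_cos hx.1 hx.2]
    have h3 : Real.sin x = 2 * Real.sin (x / 2) * Real.cos (x / 2) := by
      rw [← Real.sin_two_mul]; congr 1; ring
    rw [h3]; ring
  rw [key2, integral_sin_mul_sq_zero_pi]


/-- `∫₀¹ r·A(r)² dr = π²/2 − (√3/2)π − 5/12` (substitution `r = 2cos(x/2)`, `x ∈ [2π/3, π]`).
[folklore] -/
theorem integral_diamondRadial :
    ∫ r in (0:ℝ)..1, r * (π - 2 * Real.arcsin (r / 2) - r * Real.sqrt (1 - (r / 2) ^ 2)) ^ 2 =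
      π ^ 2 / 2 - Real.sqrt 3 / 2 * π - 5 / 12 := by
  have hab : 2 * π / 3 ≤ π := by linarith [Real.pi_pos]
  have hderiv : ∀ x ∈ uIcc (2 * π / 3) π,
      HasDerivAt (fun x : ℝ => 2 * Real.cos (x / 2)) (-Real.sin (x / 2)) x := by
    intro x _
    have := (((hasDerivAt_id x).div_const 2).cos).const_mul 2
    refine this.congr_deriv ?_
    simp only [id]; ring
  have hcont : ContinuousOn (fun x : ℝ => -Real.sin (x / 2)) (uIcc (2 * π / 3) π) :=
    (by fun_prop : Continuous fun x : ℝ => -Real.sin (x / 2)).continuousOn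
  have hg : ContinuousOn (fun r : ℝ => r * (π - 2 * Real.arcsin (r / 2) -
      r * Real.sqrt (1 - (r / 2) ^ 2)) ^ 2)
      ((fun x : ℝ => 2 * Real.cos (x / 2)) '' uIcc (2 * π / 3) π) :=
    (by fun_prop : Continuous fun r : ℝ => r * (π - 2 * Real.arcsin (r / 2) -
      r * Real.sqrt (1 - (r / 2) ^ 2)) ^ 2).continuousOn
  have key := intervalIntegral.integral_comp_mul_deriv' hderiv hcont hg
  simp only [Function.comp_apply] at key
  have h1 : 2 * Real.cos (2 * π / 3 / 2) = 1 := by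
    rw [show 2 * π / 3 / 2 = π / 3 by ring, Real.cos_pi_div_three]; ring
  rw [h1, Real.cos_pi_div_two, mul_zero, intervalIntegral.integral_symm (0:ℝ) 1] at key
  have key2 : ∫ r in (0:ℝ)..1, r * (π - 2 * Real.arcsin (r / 2) -
      r * Real.sqrt (1 - (r / 2) ^ 2)) ^ 2 =
      ∫ x in (2 * π / 3)..π, Real.sin x * (x - Real.sin x) ^ 2 := by
    rw [← neg_eq_iff_eq_neg.mpr key, ← intervalIntegral.integral_neg]
    apply intervalIntegral.integral_congr
    intro x hx
    rw [uIcc_of_le hab] at hx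
    have hx0 : 0 ≤ x := by linarith [hx.1, Real.pi_pos]
    simp only
    rw [lensArea_two_mul_cos hx0 hx.2]
    have h3 : Real.sin x = 2 * Real.sin (x / 2) * Real.cos (x / 2) := by
      rw [← Real.sin_two_mul]; congr 1; ring
    rw [h3]; ring
  rw [key2, integral_sin_mul_sq_twoPiDivThree_pi]

/-! ### From radial profiles to `lintegral`s over `(0, ∞)` -/

/-- `∫⁻_{r>0} r·A(r)² = π²/2 − 8/3` (as `ofReal`). [folklore] -/
theorem lintegral_ringRadial :
    ∫⁻ r in Ioi (0:ℝ), ENNReal.ofReal (r * (π - 2 * Real.arcsin (r / 2) -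
      r * Real.sqrt (1 - (r / 2) ^ 2)) ^ 2) = ENNReal.ofReal (π ^ 2 / 2 - 8 / 3) := by
  have hsplit : Ioi (0:ℝ) = Ioc 0 2 ∪ Ioi 2 := (Ioc_union_Ioi_eq_Ioi (by norm_num)).symm
  have hdisj : Disjoint (Ioc (0:ℝ) 2) (Ioi 2) :=
    disjoint_left.2 fun x hx hx' => (lt_irrefl (2:ℝ)) (hx'.out.trans_le hx.2 |>.trans_le le_rfl)
  rw [hsplit, lintegral_union measurableSet_Ioi hdisj]
  have hzero : ∀ r ∈ Ioi (2:ℝ), ENNReal.ofReal (r * (π - 2 * Real.arcsin (r / 2) -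
      r * Real.sqrt (1 - (r / 2) ^ 2)) ^ 2) = 0 := fun r hr => by
    rw [lensArea_eq_zero (le_of_lt hr)]; simp
  rw [setLIntegral_congr_fun measurableSet_Ioi hzero, lintegral_zero, add_zero]
  have hint : IntegrableOn (fun r : ℝ => r * (π - 2 * Real.arcsin (r / 2) -
      r * Real.sqrt (1 - (r / 2) ^ 2)) ^ 2) (Ioc 0 2) volume :=
    (Continuous.integrableOn_Icc (by fun_prop)).mono_set Ioc_subset_Icc_self
  have hnn : 0 ≤ᵐ[volume.restrict (Ioc (0:ℝ) 2)] fun r : ℝ => r * (π - 2 * Real.arcsin (r / 2) -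
      r * Real.sqrt (1 - (r / 2) ^ 2)) ^ 2 := by
    filter_upwards [ae_restrict_mem measurableSet_Ioc] with r hr
    exact mul_nonneg hr.1.le (sq_nonneg _)
  rw [← ofReal_integral_eq_lintegral_ofReal hint hnn, ← intervalIntegral.integral_of_le
    (by norm_num), integral_ringRadial]

/-- `∫⁻_{0<r<1} r·A(r)² = π²/2 − (√3/2)π − 5/12` (as `ofReal`). [folklore] -/
theorem lintegral_diamondRadial :
    ∫⁻ r in Ioo (0:ℝ) 1, ENNReal.ofReal (r * (π - 2 * Real.arcsin (r / 2) -
      r * Real.sqrt (1 - (r / 2) ^ 2)) ^ 2) =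
        ENNReal.ofReal (π ^ 2 / 2 - Real.sqrt 3 / 2 * π - 5 / 12) := by
  have hint : IntegrableOn (fun r : ℝ => r * (π - 2 * Real.arcsin (r / 2) -
      r * Real.sqrt (1 - (r / 2) ^ 2)) ^ 2) (Ioo 0 1) volume :=
    (Continuous.integrableOn_Icc (by fun_prop)).mono_set Ioo_subset_Icc_self
  have hnn : 0 ≤ᵐ[volume.restrict (Ioo (0:ℝ) 1)] fun r : ℝ => r * (π - 2 * Real.arcsin (r / 2) -
      r * Real.sqrt (1 - (r / 2) ^ 2)) ^ 2 := by
    filter_upwards [ae_restrict_mem measurableSet_Ioo] with r hr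
    exact mul_nonneg hr.1.le (sq_nonneg _)
  rw [← ofReal_integral_eq_lintegral_ofReal hint hnn, ← integral_Ioc_eq_integral_Ioo,
    ← intervalIntegral.integral_of_le zero_le_one, integral_diamondRadial]

/-! ### The ring and diamond diagrams in product coordinates `x = (r₃, (r₂, r₄))` -/

/-- The ring configuration set (pivot `r₃` first) is measurable. [folklore] -/
theorem measurableSet_ringProd : MeasurableSet {x : (ℝ × ℝ) × (ℝ × ℝ) × (ℝ × ℝ) |
    x.2.1.1 ^ 2 + x.2.1.2 ^ 2 < 1 ∧ (x.2.1.1 - x.1.1) ^ 2 + (x.2.1.2 - x.1.2) ^ 2 < 1 ∧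
      (x.1.1 - x.2.2.1) ^ 2 + (x.1.2 - x.2.2.2) ^ 2 < 1 ∧ x.2.2.1 ^ 2 + x.2.2.2 ^ 2 < 1} := by
  simp only [setOf_and]
  refine MeasurableSet.inter ?_ (MeasurableSet.inter ?_ (MeasurableSet.inter ?_ ?_)) <;>
    exact measurableSet_lt (by fun_prop) (by fun_prop)

/-- The diamond configuration set (pivot `r₃` first) is measurable. [folklore] -/
theorem measurableSet_diamondProd : MeasurableSet {x : (ℝ × ℝ) × (ℝ × ℝ) × (ℝ × ℝ) |
    x.2.1.1 ^ 2 + x.2.1.2 ^ 2 < 1 ∧ (x.2.1.1 - x.1.1) ^ 2 + (x.2.1.2 - x.1.2) ^ 2 < 1 ∧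
      (x.1.1 - x.2.2.1) ^ 2 + (x.1.2 - x.2.2.2) ^ 2 < 1 ∧ x.2.2.1 ^ 2 + x.2.2.2 ^ 2 < 1 ∧
      x.1.1 ^ 2 + x.1.2 ^ 2 < 1} := by
  simp only [setOf_and]
  refine MeasurableSet.inter ?_ (MeasurableSet.inter ?_ (MeasurableSet.inter ?_
    (MeasurableSet.inter ?_ ?_))) <;>
    exact measurableSet_lt (by fun_prop) (by fun_prop)

/-- The `r₃`-slices of the ring set are squares of the lens at `r₃`. [folklore] -/
theorem slice_ringProd (p : ℝ × ℝ) :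
    Prod.mk p ⁻¹' {x : (ℝ × ℝ) × (ℝ × ℝ) × (ℝ × ℝ) |
      x.2.1.1 ^ 2 + x.2.1.2 ^ 2 < 1 ∧ (x.2.1.1 - x.1.1) ^ 2 + (x.2.1.2 - x.1.2) ^ 2 < 1 ∧
        (x.1.1 - x.2.2.1) ^ 2 + (x.1.2 - x.2.2.2) ^ 2 < 1 ∧ x.2.2.1 ^ 2 + x.2.2.2 ^ 2 < 1} =
      {q : ℝ × ℝ | q.1 ^ 2 + q.2 ^ 2 < 1 ∧ (p.1 - q.1) ^ 2 + (p.2 - q.2) ^ 2 < 1} ×ˢ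
        {q : ℝ × ℝ | q.1 ^ 2 + q.2 ^ 2 < 1 ∧ (p.1 - q.1) ^ 2 + (p.2 - q.2) ^ 2 < 1} := by
  ext ⟨q, q'⟩
  simp only [mem_preimage, mem_setOf_eq, mem_prod]
  rw [show (q.1 - p.1) ^ 2 + (q.2 - p.2) ^ 2 = (p.1 - q.1) ^ 2 + (p.2 - q.2) ^ 2 by ring]
  tauto

/-- The `r₃`-slices of the diamond set: squares of the lens at `r₃` if `|r₃| < 1`, else empty.
[folklore] -/
theorem slice_diamondProd (p : ℝ × ℝ) :
    Prod.mk p ⁻¹' {x : (ℝ × ℝ) × (ℝ × ℝ) × (ℝ × ℝ) |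
      x.2.1.1 ^ 2 + x.2.1.2 ^ 2 < 1 ∧ (x.2.1.1 - x.1.1) ^ 2 + (x.2.1.2 - x.1.2) ^ 2 < 1 ∧
        (x.1.1 - x.2.2.1) ^ 2 + (x.1.2 - x.2.2.2) ^ 2 < 1 ∧ x.2.2.1 ^ 2 + x.2.2.2 ^ 2 < 1 ∧
        x.1.1 ^ 2 + x.1.2 ^ 2 < 1} =
      if p.1 ^ 2 + p.2 ^ 2 < 1 then
        {q : ℝ × ℝ | q.1 ^ 2 + q.2 ^ 2 < 1 ∧ (p.1 - q.1) ^ 2 + (p.2 - q.2) ^ 2 < 1} ×ˢ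
          {q : ℝ × ℝ | q.1 ^ 2 + q.2 ^ 2 < 1 ∧ (p.1 - q.1) ^ 2 + (p.2 - q.2) ^ 2 < 1}
      else ∅ := by
  ext ⟨q, q'⟩
  split_ifs with hp
  · simp only [mem_preimage, mem_setOf_eq, mem_prod]
    rw [show (q.1 - p.1) ^ 2 + (q.2 - p.2) ^ 2 = (p.1 - q.1) ^ 2 + (p.2 - q.2) ^ 2 by ring]
    tauto
  · simp only [mem_preimage, mem_setOf_eq, mem_empty_iff_false, iff_false]
    tauto

/-- **Volume of the ring diagram** in product coordinates: `2π · (π²/2 − 8/3)`. [folklore] -/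
theorem volume_ringProd :
    volume {x : (ℝ × ℝ) × (ℝ × ℝ) × (ℝ × ℝ) |
      x.2.1.1 ^ 2 + x.2.1.2 ^ 2 < 1 ∧ (x.2.1.1 - x.1.1) ^ 2 + (x.2.1.2 - x.1.2) ^ 2 < 1 ∧
        (x.1.1 - x.2.2.1) ^ 2 + (x.1.2 - x.2.2.2) ^ 2 < 1 ∧ x.2.2.1 ^ 2 + x.2.2.2 ^ 2 < 1} =
      ENNReal.ofReal (2 * π) * ENNReal.ofReal (π ^ 2 / 2 - 8 / 3) := by
  have hslice : ∀ p : ℝ × ℝ, (volume : Measure ((ℝ × ℝ) × (ℝ × ℝ)))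
      ({q : ℝ × ℝ | q.1 ^ 2 + q.2 ^ 2 < 1 ∧ (p.1 - q.1) ^ 2 + (p.2 - q.2) ^ 2 < 1} ×ˢ
        {q : ℝ × ℝ | q.1 ^ 2 + q.2 ^ 2 < 1 ∧ (p.1 - q.1) ^ 2 + (p.2 - q.2) ^ 2 < 1}) =
      ENNReal.ofReal (π - 2 * Real.arcsin (Real.sqrt (p.1 ^ 2 + p.2 ^ 2) / 2) -
        Real.sqrt (p.1 ^ 2 + p.2 ^ 2) * Real.sqrt (1 - (Real.sqrt (p.1 ^ 2 + p.2 ^ 2) / 2) ^ 2)) *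
      ENNReal.ofReal (π - 2 * Real.arcsin (Real.sqrt (p.1 ^ 2 + p.2 ^ 2) / 2) -
        Real.sqrt (p.1 ^ 2 + p.2 ^ 2) * Real.sqrt (1 - (Real.sqrt (p.1 ^ 2 + p.2 ^ 2) / 2) ^ 2)) :=
    fun p => by rw [Measure.volume_eq_prod, Measure.prod_prod, volume_lensAt_eq]
  rw [Measure.volume_eq_prod, Measure.prod_apply measurableSet_ringProd]
  simp_rw [slice_ringProd, hslice]
  rw [lintegral_radial (fun t => ENNReal.ofReal (π - 2 * Real.arcsin (Real.sqrt t / 2) -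
        Real.sqrt t * Real.sqrt (1 - (Real.sqrt t / 2) ^ 2)) *
      ENNReal.ofReal (π - 2 * Real.arcsin (Real.sqrt t / 2) -
        Real.sqrt t * Real.sqrt (1 - (Real.sqrt t / 2) ^ 2))) (by fun_prop)]
  congr 1
  rw [← lintegral_ringRadial]
  refine setLIntegral_congr_fun measurableSet_Ioi (fun r hr => ?_)
  have hr0 : 0 ≤ r := le_of_lt hr
  rw [Real.sqrt_sq hr0, ← ENNReal.ofReal_mul (lensArea_nonneg hr0), ← ENNReal.ofReal_mul hr0]
  congr 1; ring

/-- **Volume of the diamond diagram** in product coordinates: `2π · (π²/2 − (√3/2)π − 5/12)`.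
[folklore] -/
theorem volume_diamondProd :
    volume {x : (ℝ × ℝ) × (ℝ × ℝ) × (ℝ × ℝ) |
      x.2.1.1 ^ 2 + x.2.1.2 ^ 2 < 1 ∧ (x.2.1.1 - x.1.1) ^ 2 + (x.2.1.2 - x.1.2) ^ 2 < 1 ∧
        (x.1.1 - x.2.2.1) ^ 2 + (x.1.2 - x.2.2.2) ^ 2 < 1 ∧ x.2.2.1 ^ 2 + x.2.2.2 ^ 2 < 1 ∧
        x.1.1 ^ 2 + x.1.2 ^ 2 < 1} =
      ENNReal.ofReal (2 * π) * ENNReal.ofReal (π ^ 2 / 2 - Real.sqrt 3 / 2 * π - 5 / 12) := by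
  have hslice : ∀ p : ℝ × ℝ, (volume : Measure ((ℝ × ℝ) × (ℝ × ℝ)))
      (if p.1 ^ 2 + p.2 ^ 2 < 1 then
        {q : ℝ × ℝ | q.1 ^ 2 + q.2 ^ 2 < 1 ∧ (p.1 - q.1) ^ 2 + (p.2 - q.2) ^ 2 < 1} ×ˢ
          {q : ℝ × ℝ | q.1 ^ 2 + q.2 ^ 2 < 1 ∧ (p.1 - q.1) ^ 2 + (p.2 - q.2) ^ 2 < 1}
      else ∅) =
      if p.1 ^ 2 + p.2 ^ 2 < 1 then
      ENNReal.ofReal (π - 2 * Real.arcsin (Real.sqrt (p.1 ^ 2 + p.2 ^ 2) / 2) -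
        Real.sqrt (p.1 ^ 2 + p.2 ^ 2) * Real.sqrt (1 - (Real.sqrt (p.1 ^ 2 + p.2 ^ 2) / 2) ^ 2)) *
      ENNReal.ofReal (π - 2 * Real.arcsin (Real.sqrt (p.1 ^ 2 + p.2 ^ 2) / 2) -
        Real.sqrt (p.1 ^ 2 + p.2 ^ 2) * Real.sqrt (1 - (Real.sqrt (p.1 ^ 2 + p.2 ^ 2) / 2) ^ 2))
      else 0 := by
    intro p
    split_ifs
    · rw [Measure.volume_eq_prod, Measure.prod_prod, volume_lensAt_eq]
    · exact measure_empty
  rw [Measure.volume_eq_prod, Measure.prod_apply measurableSet_diamondProd]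
  simp_rw [slice_diamondProd, hslice]
  have hmF : Measurable (fun t : ℝ => if t < 1 then
      ENNReal.ofReal (π - 2 * Real.arcsin (Real.sqrt t / 2) -
        Real.sqrt t * Real.sqrt (1 - (Real.sqrt t / 2) ^ 2)) *
      ENNReal.ofReal (π - 2 * Real.arcsin (Real.sqrt t / 2) -
        Real.sqrt t * Real.sqrt (1 - (Real.sqrt t / 2) ^ 2)) else 0) :=
    Measurable.ite measurableSet_Iio (by fun_prop) measurable_const
  rw [lintegral_radial _ hmF]
  congr 1
  rw [← lintegral_diamondRadial]
  have heq : ∀ r ∈ Ioi (0:ℝ), ENNReal.ofReal r * (if r ^ 2 < 1 then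
      ENNReal.ofReal (π - 2 * Real.arcsin (Real.sqrt (r ^ 2) / 2) -
        Real.sqrt (r ^ 2) * Real.sqrt (1 - (Real.sqrt (r ^ 2) / 2) ^ 2)) *
      ENNReal.ofReal (π - 2 * Real.arcsin (Real.sqrt (r ^ 2) / 2) -
        Real.sqrt (r ^ 2) * Real.sqrt (1 - (Real.sqrt (r ^ 2) / 2) ^ 2)) else 0) =
      (Iio (1:ℝ)).indicator (fun r => ENNReal.ofReal (r * (π - 2 * Real.arcsin (r / 2) -
        r * Real.sqrt (1 - (r / 2) ^ 2)) ^ 2)) r := by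
    intro r hr
    have hr0 : 0 ≤ r := le_of_lt hr
    rw [Real.sqrt_sq hr0]
    by_cases h1 : r < 1
    · have h1' : r ^ 2 < 1 := by nlinarith
      rw [if_pos h1', indicator_of_mem (mem_Iio.2 h1), ← ENNReal.ofReal_mul (lensArea_nonneg hr0),
        ← ENNReal.ofReal_mul hr0]
      congr 1; ring
    · have h1' : ¬ r ^ 2 < 1 := fun h => h1 (by nlinarith)
      rw [if_neg h1', indicator_of_notMem (by simpa using h1), mul_zero]
  rw [setLIntegral_congr_fun measurableSet_Ioi heq, lintegral_indicator measurableSet_Iio,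
    Measure.restrict_restrict measurableSet_Iio, Iio_inter_Ioi]


end HardDiscB4Volume

end Literature.MathematicalPhysics.StatisticalMechanics

end
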